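import Literature.MathematicalPhysics.QuantumFieldTheory.Balaban1983to89.B5Eq117TorusCarriers
import HarnessLib

/-!
# Route `UnitScaleTilt`, crux K1 «MinimiserStabilityRegPr» (stmt-QuantumFields-19200), route-R E′ S3 ∕ line «HKGK-ANALYTIC», row (R-loc) brick (2d-i) —
# THE ROW FACTOR OF A BLOCK BUMP ON THE CYCLIC LABELS: `W(a) = [a.val ∕ ℓ = c]·g(a.val % ℓ)` on `ZMod N` (`ℓ ∣ N`): it vanishes off the row TOGETHER WITH its cyclic second difference
# (when `g(0) = g(ℓ−1) = 0`), its second difference ON the row is the profile's one (boundary rows included), and on the `k`-block of `y` it reads `W_i((L^k·y + j)_i) = g(j_i)`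
# (this seat's LOCATE-RLOC 7deca12a §2 ∕ ★w4-19200 g7 «BRICK 2 GO»; feeds ✓`Prop7FlatProductBump.laplace_prod_eq_zero_off` ∕ `abs_laplace_prod_le`)

Cell `ym3-torus`, twin-width seat `ym-ust-19936-w8` (gen 5).  THEOREMS ONLY (0 `def`, 0 `sorry` — the factor is the `if`-expression written out, the profile `g : ℕ → ℝ` a variable);
`--supports stmt-QuantumFields-19200 --as helper`, count-neutral.  YM₃ on T³ is a ladder rung (R3), not the Clay problem; nothing here claims S3, hKg-K, E′, the stub, the crux or the gap.

WHAT IS PROVED (ns `…Theorems.Prop7FlatBlockRowFactor`; `a b : ZMod N`, `ℓ ∣ N`, `2 ≤ ℓ`, `Fact (1 < N)`; row = `a.val ∕ ℓ`, offset = `a.val % ℓ`).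
* §1 label arithmetic: `offset_add_one` (`off(b+1) = (off b + 1) % ℓ`, always), `val_add_one_of_offset_le` ∕ `row_add_one_of_offset_le` ∕ `offset_add_one_of_offset_le` (no carry below the last offset),
  `val_sub_one_of_offset_pos` ∕ `row_sub_one_of_offset_pos` ∕ `offset_sub_one_of_offset_pos`, `offset_sub_one_of_offset_zero` (`= ℓ − 1`).
* §2 the factor: `factor_off`, ★ `d2_factor_off` (`g 0 = g (ℓ−1) = 0` ⇒ the cyclic second difference vanishes off the row), ★ `d2_factor_on` (on the row, offset `r`:
  `2W(a) − W(a+1) − W(a−1) = 2g(r) − [r ≤ ℓ−2]·g(r+1) − [1 ≤ r]·g(r−1)`), `abs_factor_le`, ★ `abs_d2_factor_le`.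
* §3 the block reading: ★ `factor_blockSiteK` (`[(x_i).val ∕ L^k = (y_i).val]·g((x_i).val % L^k) = g(j_i)` at `x = blockSiteK k y j`), `rows_iff_mem_iterBlock`
  (`L^k ∣ |T^{(0)}|` is lit ✓`BIJ85ResidualConstants.pow_dvd_sitesPerDir_zero` ∕ ✓`sitesPerDir_zero_eq`, not restated).
HONEST SCOPE.  Elementary label arithmetic; nothing of Bałaban's is asserted.

References: T. Bałaban, CMP 95 (1984) 17–40 [Balaban1984PropagatorsI] ((1.6) p.18, (1.18) p.20).
-/

set_option autoImplicit false

noncomputable section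

open scoped BigOperators

namespace Summit.QuantumFields.YangMills.Theorems.Prop7FlatBlockRowFactor

open Literature.MathematicalPhysics.QuantumFieldTheory.Balaban1983to89
open Finset LatticeFieldCalculus
open B5Eq117TorusCarriers (blockSiteK val_blockSiteK sitesPerDir_zero_eq)
open B5Eq118OneStroke (iterBlock mem_iterBlock_iff)

/-! ## §1 Label arithmetic on `ZMod N`, `ℓ ∣ N` -/

section Labels

variable {N ℓ : ℕ} [NeZero N]

/-- `off(b + 1) = (off b + 1) mod ℓ` — ALWAYS (the wrap `N − 1 ↦ 0` is a multiple of `ℓ`). [folklore] -/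
theorem offset_add_one [Fact (1 < N)] (hℓN : ℓ ∣ N) (b : ZMod N) : (b + 1).val % ℓ = (b.val % ℓ + 1) % ℓ := by
  rw [ZMod.val_add, ZMod.val_one, Nat.mod_mod_of_dvd _ hℓN, Nat.add_mod b.val 1 ℓ, Nat.add_mod (b.val % ℓ) 1 ℓ, Nat.mod_mod]

/-- No carry below the last offset: `off b ≤ ℓ − 2 ⇒ (b + 1).val = b.val + 1`. [folklore] -/
theorem val_add_one_of_offset_le [Fact (1 < N)] (hℓN : ℓ ∣ N) (hℓ : 2 ≤ ℓ) (b : ZMod N) (hr : b.val % ℓ ≤ ℓ - 2) :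
    (b + 1).val = b.val + 1 := by
  obtain ⟨q, hq⟩ := hℓN
  have hb : b.val < ℓ * q := lt_of_lt_of_eq (ZMod.val_lt b) hq
  have hℓ0 : 0 < ℓ := by omega
  have hdm := Nat.div_add_mod b.val ℓ
  have hc : b.val / ℓ < q := by
    rw [Nat.div_lt_iff_lt_mul hℓ0, mul_comm]; exact hb
  have hlt : b.val + 1 < N := by
    have h2 : ℓ * (b.val / ℓ + 1) ≤ ℓ * q := Nat.mul_le_mul_left ℓ hc
    rw [Nat.mul_add, mul_one] at h2
    have h3 : b.val + 1 < ℓ * q := by omega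
    exact lt_of_lt_of_eq h3 hq.symm
  rw [ZMod.val_add_of_lt (by rw [ZMod.val_one]; exact hlt), ZMod.val_one]

/-- … and the row does not change. [folklore] -/
theorem row_add_one_of_offset_le [Fact (1 < N)] (hℓN : ℓ ∣ N) (hℓ : 2 ≤ ℓ) (b : ZMod N) (hr : b.val % ℓ ≤ ℓ - 2) :
    (b + 1).val / ℓ = b.val / ℓ := by
  rw [val_add_one_of_offset_le hℓN hℓ b hr]
  have hℓ0 : 0 < ℓ := by omega
  have hdm := Nat.div_add_mod b.val ℓ
  have e : b.val + 1 = (b.val % ℓ + 1) + ℓ * (b.val / ℓ) := by omega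
  rw [e, Nat.add_mul_div_left _ _ hℓ0, Nat.div_eq_of_lt (by omega : b.val % ℓ + 1 < ℓ), zero_add]

/-- … and the offset goes up by one. [folklore] -/
theorem offset_add_one_of_offset_le [Fact (1 < N)] (hℓN : ℓ ∣ N) (hℓ : 2 ≤ ℓ) (b : ZMod N) (hr : b.val % ℓ ≤ ℓ - 2) :
    (b + 1).val % ℓ = b.val % ℓ + 1 := by
  rw [offset_add_one hℓN b, Nat.mod_eq_of_lt (by omega : b.val % ℓ + 1 < ℓ)]

/-- Above the first offset there is no borrow: `1 ≤ off b ⇒ (b − 1).val = b.val − 1`. [folklore] -/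
theorem val_sub_one_of_offset_pos [Fact (1 < N)] (b : ZMod N) (hr : 1 ≤ b.val % ℓ) : (b - 1).val = b.val - 1 := by
  have h1 : (1 : ZMod N).val ≤ b.val := by rw [ZMod.val_one]; exact hr.trans (Nat.mod_le _ _)
  rw [ZMod.val_sub h1, ZMod.val_one]

/-- … the row does not change. [folklore] -/
theorem row_sub_one_of_offset_pos [Fact (1 < N)] (hℓ : 2 ≤ ℓ) (b : ZMod N) (hr : 1 ≤ b.val % ℓ) : (b - 1).val / ℓ = b.val / ℓ := by
  rw [val_sub_one_of_offset_pos b hr]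
  have hℓ0 : 0 < ℓ := by omega
  have hdm := Nat.div_add_mod b.val ℓ
  have hlt : b.val % ℓ < ℓ := Nat.mod_lt _ hℓ0
  have e : b.val - 1 = (b.val % ℓ - 1) + ℓ * (b.val / ℓ) := by omega
  rw [e, Nat.add_mul_div_left _ _ hℓ0, Nat.div_eq_of_lt (by omega : b.val % ℓ - 1 < ℓ), zero_add]

/-- … and the offset goes down by one. [folklore] -/
theorem offset_sub_one_of_offset_pos [Fact (1 < N)] (hℓ : 2 ≤ ℓ) (b : ZMod N) (hr : 1 ≤ b.val % ℓ) : (b - 1).val % ℓ = b.val % ℓ - 1 := by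
  rw [val_sub_one_of_offset_pos b hr]
  have hℓ0 : 0 < ℓ := by omega
  have hdm := Nat.div_add_mod b.val ℓ
  have hlt : b.val % ℓ < ℓ := Nat.mod_lt _ hℓ0
  have e : b.val - 1 = (b.val % ℓ - 1) + ℓ * (b.val / ℓ) := by omega
  rw [e, Nat.add_mul_mod_self_left, Nat.mod_eq_of_lt (by omega : b.val % ℓ - 1 < ℓ)]

/-- At offset `0` the predecessor has offset `ℓ − 1`. [folklore] -/
theorem offset_sub_one_of_offset_zero [Fact (1 < N)] (hℓN : ℓ ∣ N) (hℓ : 2 ≤ ℓ) (b : ZMod N) (hr : b.val % ℓ = 0) : (b - 1).val % ℓ = ℓ - 1 := by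
  have h := offset_add_one hℓN (b - 1)
  rw [sub_add_cancel, hr] at h
  have hℓ0 : 0 < ℓ := by omega
  have hlt : (b - 1).val % ℓ < ℓ := Nat.mod_lt _ hℓ0
  by_contra hne
  have hlt' : (b - 1).val % ℓ + 1 < ℓ := by omega
  rw [Nat.mod_eq_of_lt hlt'] at h
  omega

end Labels

/-! ## §2 The row factor `W(a) = [a.val ∕ ℓ = c]·g(a.val % ℓ)` -/

section Factor

variable {N ℓ : ℕ} [NeZero N]

omit [NeZero N] in
/-- Off the row the factor vanishes. [folklore] -/
theorem factor_off (c : ℕ) (g : ℕ → ℝ) (a : ZMod N) (ha : a.val / ℓ ≠ c) :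
    (if a.val / ℓ = c then g (a.val % ℓ) else 0) = 0 := if_neg ha

/-- ★ **OFF THE ROW THE CYCLIC SECOND DIFFERENCE VANISHES TOO** (the profile vanishes at both ends of the row, so the two labels adjacent to the row carry the value `0`). [folklore] -/
theorem d2_factor_off [Fact (1 < N)] (hℓN : ℓ ∣ N) (hℓ : 2 ≤ ℓ) (c : ℕ) (g : ℕ → ℝ) (hg0 : g 0 = 0) (hgl : g (ℓ - 1) = 0)
    (a : ZMod N) (ha : a.val / ℓ ≠ c) :
    2 * (if a.val / ℓ = c then g (a.val % ℓ) else 0) - (if (a + 1).val / ℓ = c then g ((a + 1).val % ℓ) else 0)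
      - (if (a - 1).val / ℓ = c then g ((a - 1).val % ℓ) else 0) = 0 := by
  have hℓ0 : 0 < ℓ := by omega
  have hlt : a.val % ℓ < ℓ := Nat.mod_lt _ hℓ0
  -- the forward neighbour
  have hplus : (if (a + 1).val / ℓ = c then g ((a + 1).val % ℓ) else 0) = 0 := by
    by_cases hr : a.val % ℓ ≤ ℓ - 2
    · rw [if_neg]; rw [row_add_one_of_offset_le hℓN hℓ a hr]; exact ha
    · have hoff : (a + 1).val % ℓ = 0 := by
        rw [offset_add_one hℓN a, show a.val % ℓ + 1 = ℓ by omega, Nat.mod_self]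
      rw [hoff, hg0]; split_ifs <;> rfl
  -- the backward neighbour
  have hminus : (if (a - 1).val / ℓ = c then g ((a - 1).val % ℓ) else 0) = 0 := by
    by_cases hr : 1 ≤ a.val % ℓ
    · rw [if_neg]; rw [row_sub_one_of_offset_pos hℓ a hr]; exact ha
    · have hoff : (a - 1).val % ℓ = ℓ - 1 := offset_sub_one_of_offset_zero hℓN hℓ a (by omega)
      rw [hoff, hgl]; split_ifs <;> rfl
  rw [if_neg ha, hplus, hminus]; ring

/-- ★ **ON THE ROW, THE SECOND DIFFERENCE IS THE PROFILE'S** (boundary rows included): at offset `r`,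
`2W(a) − W(a+1) − W(a−1) = 2g(r) − [r ≤ ℓ−2]·g(r+1) − [1 ≤ r]·g(r−1)` (again because `g(0) = g(ℓ−1) = 0` makes the out-of-row neighbours read `0`). [folklore] -/
theorem d2_factor_on [Fact (1 < N)] (hℓN : ℓ ∣ N) (hℓ : 2 ≤ ℓ) (c : ℕ) (g : ℕ → ℝ) (hg0 : g 0 = 0) (hgl : g (ℓ - 1) = 0)
    (a : ZMod N) (ha : a.val / ℓ = c) :
    2 * (if a.val / ℓ = c then g (a.val % ℓ) else 0) - (if (a + 1).val / ℓ = c then g ((a + 1).val % ℓ) else 0)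
      - (if (a - 1).val / ℓ = c then g ((a - 1).val % ℓ) else 0)
      = 2 * g (a.val % ℓ) - (if a.val % ℓ ≤ ℓ - 2 then g (a.val % ℓ + 1) else 0) - (if 1 ≤ a.val % ℓ then g (a.val % ℓ - 1) else 0) := by
  have hℓ0 : 0 < ℓ := by omega
  have hlt : a.val % ℓ < ℓ := Nat.mod_lt _ hℓ0
  have hplus : (if (a + 1).val / ℓ = c then g ((a + 1).val % ℓ) else 0) = (if a.val % ℓ ≤ ℓ - 2 then g (a.val % ℓ + 1) else 0) := by
    by_cases hr : a.val % ℓ ≤ ℓ - 2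
    · rw [if_pos hr, if_pos (by rw [row_add_one_of_offset_le hℓN hℓ a hr, ha]), offset_add_one_of_offset_le hℓN hℓ a hr]
    · rw [if_neg hr]
      have hoff : (a + 1).val % ℓ = 0 := by
        rw [offset_add_one hℓN a, show a.val % ℓ + 1 = ℓ by omega, Nat.mod_self]
      rw [hoff, hg0]; split_ifs <;> rfl
  have hminus : (if (a - 1).val / ℓ = c then g ((a - 1).val % ℓ) else 0) = (if 1 ≤ a.val % ℓ then g (a.val % ℓ - 1) else 0) := by
    by_cases hr : 1 ≤ a.val % ℓ
    · rw [if_pos hr, if_pos (by rw [row_sub_one_of_offset_pos hℓ a hr, ha]), offset_sub_one_of_offset_pos hℓ a hr]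
    · rw [if_neg hr]
      have hoff : (a - 1).val % ℓ = ℓ - 1 := offset_sub_one_of_offset_zero hℓN hℓ a (by omega)
      rw [hoff, hgl]; split_ifs <;> rfl
  rw [if_pos ha, hplus, hminus]

omit [NeZero N] in
/-- The factor is bounded by the profile's bound. [folklore] -/
theorem abs_factor_le (hℓ : 2 ≤ ℓ) (c : ℕ) (g : ℕ → ℝ) {M : ℝ} (hM0 : 0 ≤ M) (hM : ∀ r, r < ℓ → |g r| ≤ M) (a : ZMod N) :
    |(if a.val / ℓ = c then g (a.val % ℓ) else 0)| ≤ M := by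
  split_ifs
  · exact hM _ (Nat.mod_lt _ (by omega))
  · rw [abs_zero]; exact hM0

/-- ★ **THE CYCLIC SECOND DIFFERENCE OF THE FACTOR IS BOUNDED BY THE PROFILE'S** (interior bound `K` for `1 ≤ r ≤ ℓ−2`, boundary rows `|2g(0) − g(1)| ≤ K`, `|2g(ℓ−1) − g(ℓ−2)| ≤ K`). [folklore] -/
theorem abs_d2_factor_le [Fact (1 < N)] (hℓN : ℓ ∣ N) (hℓ : 2 ≤ ℓ) (c : ℕ) (g : ℕ → ℝ) (hg0 : g 0 = 0) (hgl : g (ℓ - 1) = 0) {K : ℝ} (hK0 : 0 ≤ K)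
    (hKint : ∀ r, 1 ≤ r → r ≤ ℓ - 2 → |2 * g r - g (r + 1) - g (r - 1)| ≤ K)
    (hKfirst : |2 * g 0 - g 1| ≤ K) (hKlast : |2 * g (ℓ - 1) - g (ℓ - 2)| ≤ K) (a : ZMod N) :
    |2 * (if a.val / ℓ = c then g (a.val % ℓ) else 0) - (if (a + 1).val / ℓ = c then g ((a + 1).val % ℓ) else 0)
      - (if (a - 1).val / ℓ = c then g ((a - 1).val % ℓ) else 0)| ≤ K := by
  have hℓ0 : 0 < ℓ := by omega
  have hlt : a.val % ℓ < ℓ := Nat.mod_lt _ hℓ0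
  by_cases ha : a.val / ℓ = c
  · rw [d2_factor_on hℓN hℓ c g hg0 hgl a ha]
    set r := a.val % ℓ with hr
    by_cases h1 : 1 ≤ r
    · by_cases h2 : r ≤ ℓ - 2
      · rw [if_pos h2, if_pos h1]; exact hKint r h1 h2
      · rw [if_neg h2, if_pos h1, sub_zero]
        have hrl : r = ℓ - 1 := by omega
        rw [hrl, show ℓ - 1 - 1 = ℓ - 2 by omega]; exact hKlast
    · have hr0 : r = 0 := by omega
      rw [if_neg h1, sub_zero, hr0, if_pos (by omega), zero_add]; exact hKfirst
  · rw [d2_factor_off hℓN hℓ c g hg0 hgl a ha, abs_zero]; exact hK0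

end Factor

/-! ## §3 The block reading -/

variable {P : Params} {k : ℕ}

/-- ★ **ON THE `k`-BLOCK OF `y` THE FACTOR READS THE PROFILE AT THE OFFSET**: at `x = blockSiteK k y j` (labels `(x_i).val = L^k·(y_i).val + j_i`), the `i`-th row test holds and
`[(x_i).val ∕ L^k = (y_i).val]·g((x_i).val % L^k) = g(j_i)`. [cite: Balaban1984PropagatorsI, (1.6) p.18, (1.18) p.20] -/
theorem factor_blockSiteK (hk : k ≤ P.m + P.K) (y : Site P k) (j : Fin P.d → Fin (P.L ^ k)) (g : ℕ → ℝ) (i : Fin P.d) :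
    (if ((blockSiteK k y j) i).val / P.L ^ k = (y i).val then g (((blockSiteK k y j) i).val % P.L ^ k) else 0) = g (j i) := by
  have hℓ0 : 0 < P.L ^ k := pow_pos P.L_pos k
  rw [val_blockSiteK hk, mul_comm, Nat.mul_add_div hℓ0, Nat.div_eq_of_lt (j i).isLt, add_zero, if_pos rfl, Nat.mul_add_mod,
    Nat.mod_eq_of_lt (j i).isLt]

/-- `x` passes every row test iff `x ∈ B^k(y)` (✓`mem_iterBlock_iff`). [cite: Balaban1984PropagatorsI, (1.18) p.20] -/
theorem rows_iff_mem_iterBlock (hk : k ≤ P.m + P.K) (y : Site P k) (x : Site P 0) :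
    (∀ i : Fin P.d, (x i).val / P.L ^ k = (y i).val) ↔ x ∈ iterBlock k y :=
  (mem_iterBlock_iff hk y x).symm

end Summit.QuantumFields.YangMills.Theorems.Prop7FlatBlockRowFactor

end
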